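import Literature.Analysis.InverseSpectral.KreinStringStieltjes
import Literature.Analysis.InverseSpectral.StieltjesRational
import HarnessLib

/-!
# Kreĭn's theorem for rational Stieltjes functions

**Every rational Stieltjes function is the principal Titchmarsh–Weyl function of a (Stieltjes)
string**: if `q(z) = b + Σ_{λ ∈ s} c_λ/(λ - z)` with `b ≥ 0`, finitely many atoms `λ ≥ 0` with
weights `c_λ > 0`, and `q ≢ 0`, then `q = q_S` on `ℂ ∖ [0, ∞)` for a Kreĭn string `S` other than
the free half-line (`exists_string_of_finite_atoms`, `exists_string_of_finitelyAtomic`). The proof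
is Stieltjes' algorithm (Stieltjes 1894; Kreĭn 1952; Kac–Kreĭn 1974 §2): strip the constant `b`
(a massless segment, `KreinStringShift`), then the point mass `m₀ = 1/Σ c_λ` at the left end
(`KreinStringOperations`); the remaining function `r = (Σ c) N/D` is again a Stieltjes function
(`StieltjesRational`, positivity of `Im (N conj D)`), finitely atomic with fewer atoms (its measure
lives on the zeros of `D`, located by Stieltjes inversion, `StieltjesInversion`), and induction
applies. This is the existence part (iii) of `KreinInverseSpectralTheorem` for rational data.

## References

KacKrein1974 (§2, Supplement II), DymMcKean1976 (§5.8).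
-/

open MeasureTheory Filter Set Topology Finset
open scoped ENNReal

noncomputable section

namespace Literature.Analysis.InverseSpectral

open StieltjesRational

namespace KreinString

/-- **Kreĭn's theorem for rational Stieltjes functions** (by the number of atoms): for
`b ≥ 0`, atoms `λ ≥ 0` (`λ ∈ s`) with weights `c_λ > 0`, not both `s = ∅` and `b = 0`, there is a
string other than the free half-line with `q_S(z) = b + Σ c_λ/(λ - z)` off `[0, ∞)`.
[cite: KacKrein1974, §2] -/
theorem exists_string_of_finite_atoms (n : ℕ) :
    ∀ (s : Finset ℝ) (c : ℝ → ℝ) (b : ℝ), s.card ≤ n → (∀ l ∈ s, 0 ≤ l) → (∀ l ∈ s, 0 < c l) →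
      0 ≤ b → (s.Nonempty ∨ 0 < b) →
      ∃ S : KreinString, ¬ S.IsTrivial ∧
        ∀ z ∈ offNonnegAxis, S.principalWeylFunction z = b + ratNum s c z := by
  classical
  induction n with
  | zero =>
    intro s c b hcard hs hc hb hne
    have hs0 : s = ∅ := Finset.card_eq_zero.1 (Nat.le_zero.1 hcard)
    subst hs0
    have hb0 : 0 < b := by simpa using hne
    refine ⟨empty b hb0, not_isTrivial_empty b hb0, fun z hz => ?_⟩
    rw [principalWeylFunction_empty]
    simp [ratNum]
  | succ n ih =>
    intro s c b hcard hs hc hb hne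
    by_cases hs0 : s = ∅
    · subst hs0
      have hb0 : 0 < b := by simpa using hne
      refine ⟨empty b hb0, not_isTrivial_empty b hb0, fun z hz => ?_⟩
      rw [principalWeylFunction_empty]
      simp [ratNum]
    by_cases hpos : ∃ l ∈ s, 0 < l
    · -- the inverse Stieltjes step
      obtain ⟨F, c', b', hFcard, hF0, hc', hb', hr⟩ := ratNext_eq_finite hs hc hpos
      have hFn : F.card ≤ n := by omega
      -- `r ≢ 0`
      have hne' : F.Nonempty ∨ 0 < b' := by
        by_contra hcon
        rw [not_or, Finset.not_nonempty_iff_eq_empty, not_lt] at hcon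
        have hb0 : b' = 0 := le_antisymm hcon.2 hb'
        have hz : (-(1 : ℂ)) ∈ offNonnegAxis := Or.inr (by simp)
        have h1 := (ratNum_eq_ratNext_div hs hc hpos hz).2
        rw [hr _ hz, hcon.1, hb0] at h1
        simp [ratNum] at h1
        obtain ⟨l₀, hl₀⟩ := Finset.nonempty_iff_ne_empty.2 hs0
        have hsum : 0 < ∑ l ∈ s, c l / (l + 1) :=
          Finset.sum_pos' (fun l hl => div_nonneg (hc l hl).le (by linarith [hs l hl]))
            ⟨l₀, hl₀, div_pos (hc l₀ hl₀) (by linarith [hs l₀ hl₀])⟩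
        have h3 : ((∑ l ∈ s, c l / (l + 1) : ℝ) : ℂ) = 0 := by push_cast; exact h1
        have h4 : (∑ l ∈ s, c l / (l + 1) : ℝ) = 0 := by exact_mod_cast h3
        linarith
      obtain ⟨S', hS', hq'⟩ := ih F c' b' hFn hF0 hc' hb' hne'
      -- put back the point mass `m₀ = 1/Σ c`
      set C := ∑ l ∈ s, c l with hC
      obtain ⟨l₀, hl₀⟩ := Finset.nonempty_iff_ne_empty.2 hs0
      have hC0 : 0 < C := Finset.sum_pos' (fun l hl => (hc l hl).le) ⟨l₀, hl₀, hc l₀ hl₀⟩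
      have hm₀ : 0 < C⁻¹ := inv_pos.2 hC0
      have hN : ∀ z ∈ offNonnegAxis, (S'.addDirac C⁻¹).principalWeylFunction z = ratNum s c z := by
        intro z hz
        rw [(S'.principalWeylFunction_addDirac hm₀ hS' hz).2, hq' z hz, ← hr z hz,
          (ratNum_eq_ratNext_div hs hc hpos hz).2, Complex.ofReal_inv]
      rcases eq_or_lt_of_le hb with hb0 | hb0
      · refine ⟨S'.addDirac C⁻¹, S'.not_isTrivial_addDirac hm₀, fun z hz => ?_⟩
        rw [hN z hz, ← hb0, Complex.ofReal_zero, zero_add]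
      · refine ⟨(S'.addDirac C⁻¹).prepend b hb0.le,
          (S'.addDirac C⁻¹).not_isTrivial_prepend hb0.le (S'.not_isTrivial_addDirac hm₀),
          fun z hz => ?_⟩
        rw [(S'.addDirac C⁻¹).principalWeylFunction_prepend hb0 (S'.not_isTrivial_addDirac hm₀) hz,
          hN z hz]
    · -- all atoms are `0`: `s = {0}`
      push Not at hpos
      have hs00 : s = {0} := by
        ext l
        simp only [Finset.mem_singleton]
        constructor
        · intro hl; exact le_antisymm (hpos l hl) (hs l hl)
        · rintro rfl
          obtain ⟨l₀, hl₀⟩ := Finset.nonempty_iff_ne_empty.2 hs0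
          have : l₀ = 0 := le_antisymm (hpos l₀ hl₀) (hs l₀ hl₀)
          exact this ▸ hl₀
      subst hs00
      obtain ⟨S, hS, hq⟩ := exists_string_one_atom hb (hc 0 (Finset.mem_singleton_self 0)) le_rfl
      refine ⟨S, hS, fun z hz => ?_⟩
      rw [hq z hz]
      simp [ratNum]

/-- **Kreĭn's theorem for finitely atomic Stieltjes data**: if `q` has Stieltjes data
`(b, Σ_{λ ∈ s} c_λ δ_λ)` (`λ ≥ 0`, `c_λ > 0`) and `q ≢ 0` off `[0, ∞)`, then `q` is the principal
Titchmarsh–Weyl function of a string other than the free half-line — conjunct (iii) of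
`KreinInverseSpectralTheorem` for rational `q`. [cite: KacKrein1974, §2] -/
theorem exists_string_of_finitelyAtomic {q : ℂ → ℂ} {b : ℝ} {s : Finset ℝ} {c : ℝ → ℝ}
    (hs : ∀ l ∈ s, 0 ≤ l) (hc : ∀ l ∈ s, 0 < c l)
    (hq : HasStieltjesRepresentation q b (∑ l ∈ s, ENNReal.ofReal (c l) • Measure.dirac l))
    (hne : ∃ z ∈ offNonnegAxis, q z ≠ 0) :
    ∃ S : KreinString, ¬ S.IsTrivial ∧ Set.EqOn S.principalWeylFunction q offNonnegAxis := by
  have hrat := hasStieltjesRepresentation_ratNum (c := c) hs (fun l hl => (hc l hl).le)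
  have hqz : ∀ z ∈ offNonnegAxis, q z = b + ratNum s c z := fun z hz => by
    rw [hq.2.2.2 z hz, hrat.2.2.2 z hz, Complex.ofReal_zero, zero_add]
  have hne' : s.Nonempty ∨ 0 < b := by
    by_contra hcon
    rw [not_or, Finset.not_nonempty_iff_eq_empty, not_lt] at hcon
    obtain ⟨z, hz, hqz0⟩ := hne
    apply hqz0
    rw [hqz z hz, hcon.1, le_antisymm hcon.2 hq.1]
    simp [ratNum]
  obtain ⟨S, hS, hqS⟩ := exists_string_of_finite_atoms s.card s c b le_rfl hs hc hq.1 hne'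
  exact ⟨S, hS, fun z hz => by rw [hqS z hz, hqz z hz]⟩

end KreinString

end Literature.Analysis.InverseSpectral

end
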